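import Mathlib.RepresentationTheory.Homological.GroupCohomology.LowDegree
import Literature.NumberTheory.EllipticCurves.ComplexMultiplicationCoatesWiles
import Literature.NumberTheory.EllipticCurves.ComplexMultiplicationDeuringFrobeniusProofs
import HarnessLib

/-!
# Coates–Wiles (1977), Theorem 11: Sah's lemma and the Lang–Mazur Kummer argument

Topic `NumberTheory/EllipticCurves`; proof sibling (theorems only: no definition, no named fact,
no instance) of `Literature/NumberTheory/EllipticCurves/ComplexMultiplicationCoatesWiles.lean`,
serving the named fact `Literature.NumberTheory.EllipticCurves.CoatesWiles1977_L_one_div_period_mem_prime`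
(Coates–Wiles, Invent. Math. 39 (1977), §6 p. 250).

In the proof of that fact (CW §6, p. 250) the point `P` of infinite order enters through
**Lemma 35**: with `π^{n+1} Q_n = P`, the Kummer extensions `H_n F_∞ / F_∞` are non-trivial (and
ramified) for all large `n`. Lemma 35 is the global shadow of **Theorem 11** (CW §3, p. 231): for
`α ≠ 0` in `ℰ(𝔭)` and `[π^{n+1}] α_n = α`, the extension `Φ_∞(α_n)/Φ_∞` is non-trivial and
ramified for all sufficiently large `n`. Coates–Wiles prove Theorem 11 by an argument of Lang and
Mazur (§3, p. 231) whose only inputs are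

* (a) a cohomological lemma of **Sah** (Sah 1968, Prop. 2.7 (b) and its proof, p. 60: for `x` in
  the centre of `Γ`, `σ_* − 1 = (σ − 1)_*` on `H^q(Γ, M)`, and conjugation by `x` together with
  multiplication by `x` induce the identity on cohomology; hence `H^q(Γ, M) = 0` as soon as
  `x − 1` is an automorphism of `M`), giving `H¹(G_∞, ℰ_{π^{n+1}}) = 0`;
* (b) the Kummer cocycle `c_σ = σ α_n ⊖ α_n` with values in `ℰ_{π^{n+1}}`: if `α_n ∈ Φ_∞` then,
  `H¹` being zero, `c_σ = σ v_n ⊖ v_n` with `v_n ∈ ℰ_{π^{n+1}}`, so `α_n ⊖ v_n ∈ K_𝔭` and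
  `α ∈ [π^{n+1}] ℰ(𝔭)`;
* (c) `⋂_n [π^{n+1}] ℰ(𝔭) = 0` (because `[π^{n+1}] ℰ(𝔭) ⊆ ℰ(𝔭^{n+2})`), contradicting `α ≠ 0`.

Inputs (a) and (b) and the passage to (c) are pure group cohomology / module theory, and this
file proves them in that generality, for a group `G` acting on an additive commutative group `M`
(`DistribMulAction G M`; in CW: `G = G_∞ = G(Φ_∞/K_𝔭)`, abelian, `M = ℰ(Φ_∞)`, `π` the
endomorphism `[π]` of the Lubin–Tate group `ℰ`, `g` any element with `χ(g)` a non-trivial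
`(p−1)`-st root of unity, so that `χ(g) − 1 ∈ ℤ_p^×` acts bijectively on every `ℰ_{π^{n+1}}`):

1. `smul_map_sub_map_eq_of_isCocycle₁` — for a `1`-cocycle `f` and commuting `g, h`:
   `g • f h − f h = h • f g − f g`, i.e. `(g − 1) f = ∂(f g)` [Sah's mechanism];
2. `isCoboundary₁_smul_map_sub_map_of_mem_center` — **Sah's lemma, annihilation form**: for
   `g ∈ Z(G)` the cocycle `(g − 1) f` is a coboundary;
3. `eq_smul_sub_of_isCocycle₁_of_mem_center`, `exists_eq_smul_sub_of_mem_center_of_bijOn`,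
   `isCoboundary₁_of_mem_center_of_bijective` — **Sah's lemma, vanishing form**: if `g ∈ Z(G)`
   and `x ↦ g • x − x` is bijective on a `G`-stable subgroup `T ⊇ f(G)` (resp. on `M`), then `f`
   is the coboundary of an element of `T` (resp. `H¹(G, M) = 0` at the level of cocycles);
   `bijective_smul_sub_of_smul_eq_smul` — the bijectivity when `g` acts as a scalar `c` with
   `c − 1` a unit (the case `χ(g) − 1 ∈ ℤ_p^×` of CW);
4. `H1π_eq_zero_of_mem_center_of_bijective`, `subsingleton_H1_of_mem_center_of_bijective` — the
   same for Mathlib's `groupCohomology.H1` of a `k`-linear representation `A : Rep k G`;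
5. `isCocycle₁_smul_sub`, `exists_fixed_apply_eq_of_forall_isCocycle₁`,
   `exists_fixed_apply_eq_of_mem_center` — **the Lang–Mazur Kummer step (b)**: for a
   `G`-equivariant additive endomorphism `φ` of `M` (CW: `φ = [π^{n+1}]`), a `G`-fixed `α` and any
   `y ∈ M` with `φ y = α`, if `H¹(G, ker φ) = 0` (resp. under Sah's hypothesis on `ker φ`) then
   `α = φ β` for a `G`-fixed `β` (CW: "`α` belongs to `[π^{n+1}] ℰ(𝔭)`");
6. `eventually_forall_pow_apply_ne_of_mem_center` — **the algebraic skeleton of Theorem 11**: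
   if moreover `⋂_n π^{n+1}(M^G) = 0` (input (c), here a hypothesis) and `α ≠ 0`, then for all
   large `n` no `y ∈ M` satisfies `π^{n+1} y = α` (CW: "`α_n ∉ Φ_∞`", i.e. `Φ_∞(α_n) ≠ Φ_∞`);
7. `conj_smul_sub_eq_smul`, `smul_eq_self_of_conj_smul_eq`, `exists_conj_smul_ne` — the
   algebraic part of the **ramification half** of Theorem 11 (CW p. 231: "`G_0` acts on
   `G(Φ_∞(α_n)/Φ_∞)` via the first power of `χ` … hence, if `Φ_∞(α_n)` is a non-trivial
   extension of `Φ_∞`, it cannot be abelian over `K_𝔭`"): the Kummer map `τ ↦ τ • y − y` is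
   `χ`-equivariant under conjugation, so an element `g` with `g − 1` injective on `ker φ` cannot
   commute with a `τ` moving `y`;
8. `eq_one_of_modEq_one_of_sq_le`, `frobeniusTrace_modEq_one_iff`,
   `frobeniusTrace_ne_one_iff_not_modEq` — the arithmetic step of **Lemma 12** (CW pp. 231–232):
   for a prime `p > 5` of good reduction, `a_p ≡ 1 (mod p) ↔ a_p = 1` (Hasse), identifying the
   non-anomalous hypothesis `W.frobeniusTrace p ≠ 1` of the named fact with the congruence form
   in which the norm-group computation of Lemma 12 produces it.

What is deliberately NOT here: the objects of CW §§2–3 themselves (the Lubin–Tate group `ℰ` of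
`E` at `𝔭`, the towers `Φ_n`, the character `χ : G_∞ ≅ ℤ_p^×`, input (c) for `ℰ(𝔭)`, and the
last step of the ramification half of Theorem 11: unramified extensions of `Φ_∞` are abelian
over `K_𝔭`; the class-field-theoretic content of Lemma 12: `μ_p ⊂ Φ_0 ↔ π + π̄ ≡ 1 mod p`) —
local class field theory and Lubin–Tate theory are not in Mathlib; apart from item 8 nothing in
this file is specific to elliptic curves. No new definitions and no
named facts are introduced (D-0026); the theorems are stated over Mathlib's
`groupCohomology.IsCocycle₁` / `IsCoboundary₁` / `H1`.

## References

* [CoatesWiles1977] J. Coates, A. Wiles, *On the conjecture of Birch and Swinnerton-Dyer*,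
  Invent. Math. 39 (1977), 223–251: Theorem 11 and its proof after Lang–Mazur, §3 p. 231;
  Lemma 35, §6 p. 250. doi:10.1007/BF01402975
* [Sah1968] C.-H. Sah, *Automorphisms of finite groups*, J. Algebra 10 (1968), 47–68:
  Prop. 2.7 (b) and its proof, p. 60 (reference [14] of Coates–Wiles). doi:10.1016/0021-8693(68)90104-x
-/

universe u

namespace Literature.NumberTheory.EllipticCurves

open groupCohomology

namespace CoatesWiles1977

/-! ### Sah's lemma (elementary form, for `DistribMulAction G M`) -/

section Sah

variable {G M : Type*} [Group G] [AddCommGroup M] [DistribMulAction G M]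

/-- **Sah's mechanism.** For a `1`-cocycle `f : G → M` (`f (gh) = g • f h + f g`) and commuting
`g, h ∈ G`: `g • f h − f h = h • f g − f g`; i.e. the cocycle `(g − 1) f` is the coboundary of the
element `f g` (Sah 1968, proof of Prop. 2.7 (b): `σ_* − 1 = (σ − 1)_*` vanishes on cohomology for
central `σ`). [cite: Sah1968, Prop. 2.7 (b) and its proof, p. 60] -/
theorem smul_map_sub_map_eq_of_isCocycle₁ {f : G → M} (hf : IsCocycle₁ f) {g h : G}
    (hgh : g * h = h * g) : g • f h - f h = h • f g - f g := by
  have h1 := hf g h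
  have h2 := hf h g
  rw [hgh] at h1
  exact sub_eq_sub_iff_add_eq_add.2 (h1.symm.trans h2)

/-- **Sah's lemma, annihilation form** (Sah 1968, Prop. 2.7 (b), degree `1`): for `g` in the
centre of `G` and any `1`-cocycle `f : G → M`, the `1`-cocycle `h ↦ g • f h − f h` is a
`1`-coboundary (namely `∂(f g)`): `g − 1` annihilates `H¹(G, M)`.
[cite: Sah1968, Prop. 2.7 (b) and its proof, p. 60] -/
theorem isCoboundary₁_smul_map_sub_map_of_mem_center {f : G → M} (hf : IsCocycle₁ f) {g : G}
    (hg : g ∈ Subgroup.center G) : IsCoboundary₁ (fun h => g • f h - f h) :=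
  ⟨f g, fun h =>
    (smul_map_sub_map_eq_of_isCocycle₁ hf ((Subgroup.mem_center_iff.1 hg h).symm)).symm⟩

/-- **Sah's lemma, vanishing form, with supports.** Let `f : G → M` be a `1`-cocycle with values
in a `G`-stable additive subgroup `T`, let `g ∈ Z(G)` be such that `x ↦ g • x − x` is injective
on `T`, and let `x ∈ T` satisfy `g • x − x = f g`. Then `f = ∂x`, i.e. `σ • x − x = f σ` for all
`σ` (apply the injective `g − 1` to both sides and use Sah's mechanism).
[cite: Sah1968, Prop. 2.7 (b) and its proof, p. 60] -/
theorem eq_smul_sub_of_isCocycle₁_of_mem_center {f : G → M} (hf : IsCocycle₁ f) {g : G}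
    (hg : g ∈ Subgroup.center G) (T : AddSubgroup M) (hT : ∀ (σ : G) (x : M), x ∈ T → σ • x ∈ T)
    (hfT : ∀ σ : G, f σ ∈ T) (hinj : Set.InjOn (fun x : M => g • x - x) T) {x : M} (hx : x ∈ T)
    (hgx : g • x - x = f g) (σ : G) : σ • x - x = f σ := by
  have hσg : σ * g = g * σ := Subgroup.mem_center_iff.1 hg σ
  have key : g • f σ - f σ = σ • f g - f g := smul_map_sub_map_eq_of_isCocycle₁ hf hσg.symm
  have comm : g • σ • x = σ • g • x := by rw [smul_smul, smul_smul, hσg]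
  have e : g • (σ • x - x) - (σ • x - x) = σ • (g • x - x) - (g • x - x) := by
    rw [smul_sub, smul_sub, comm]
    abel
  refine hinj (T.sub_mem (hT σ x hx) hx) (hfT σ) ?_
  show g • (σ • x - x) - (σ • x - x) = g • f σ - f σ
  rw [e, hgx, key]

/-- **Sah's lemma, vanishing form** (Sah 1968, Prop. 2.7 (b), `q = 1`): if `g ∈ Z(G)` and
`x ↦ g • x − x` is a bijection of the `G`-stable additive subgroup `T` onto itself, then every
`1`-cocycle with values in `T` is the coboundary of an element of `T` — `H¹(G, T) = 0`.
[cite: Sah1968, Prop. 2.7 (b) and its proof, p. 60] -/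
theorem exists_eq_smul_sub_of_mem_center_of_bijOn {g : G} (hg : g ∈ Subgroup.center G)
    (T : AddSubgroup M) (hT : ∀ (σ : G) (x : M), x ∈ T → σ • x ∈ T)
    (hbij : Set.BijOn (fun x : M => g • x - x) T T) {f : G → M} (hf : IsCocycle₁ f)
    (hfT : ∀ σ : G, f σ ∈ T) : ∃ x ∈ T, ∀ σ : G, σ • x - x = f σ := by
  obtain ⟨x, hx, hgx⟩ := hbij.surjOn (hfT g)
  exact ⟨x, hx, eq_smul_sub_of_isCocycle₁_of_mem_center hf hg T hT hfT hbij.injOn hx hgx⟩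

/-- **Sah's lemma, vanishing form on `M`** (Sah 1968, Prop. 2.7 (b), `q = 1`): if `g ∈ Z(G)`
and `x ↦ g • x − x` is bijective on `M`, then every `1`-cocycle `G → M` is a `1`-coboundary,
i.e. `H¹(G, M) = 0`. [cite: Sah1968, Prop. 2.7 (b) and its proof, p. 60] -/
theorem isCoboundary₁_of_mem_center_of_bijective {g : G} (hg : g ∈ Subgroup.center G)
    (hbij : Function.Bijective fun x : M => g • x - x) {f : G → M} (hf : IsCocycle₁ f) :
    IsCoboundary₁ f := by
  obtain ⟨x, hgx⟩ := hbij.2 (f g)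
  exact ⟨x, eq_smul_sub_of_isCocycle₁_of_mem_center hf hg ⊤ (fun _ _ _ => trivial)
    (fun _ => trivial) (hbij.1.injOn) trivial hgx⟩

/-- The abelian case: in a commutative `G` every element is central, so `H¹(G, M) = 0` as soon as
some `g ∈ G` has `g − 1` bijective on `M` (the form used by Coates–Wiles for
`G_∞ = G(Φ_∞/K_𝔭) ≅ ℤ_p^×`). [cite: CoatesWiles1977, §3 p. 231 (proof of Thm. 11)] -/
theorem isCoboundary₁_of_comm_of_bijective (hcomm : ∀ a b : G, a * b = b * a) (g : G)
    (hbij : Function.Bijective fun x : M => g • x - x) {f : G → M} (hf : IsCocycle₁ f) :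
    IsCoboundary₁ f :=
  isCoboundary₁_of_mem_center_of_bijective (Subgroup.mem_center_iff.2 fun h => hcomm h g) hbij hf

/-- If `g` acts on `M` as the scalar `c` of a ring `R` and `c − 1` is a unit, then `x ↦ g • x − x`
is bijective (Coates–Wiles: `χ(g) − 1 ∈ ℤ_p^×` on `ℰ_{π^{n+1}} ≅ 𝓞_𝔭/𝔭^{n+1}`). [folklore] -/
theorem bijective_smul_sub_of_smul_eq_smul {R : Type*} [Ring R] [Module R M] {g : G} {c : R}
    (hc : ∀ x : M, g • x = c • x) (hu : IsUnit (c - 1)) :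
    Function.Bijective fun x : M => g • x - x := by
  obtain ⟨u, hu'⟩ := hu
  have e : (fun x : M => g • x - x) = fun x => u • x := funext fun x => by
    rw [hc, Units.smul_def, hu', sub_smul, one_smul]
  rw [e]
  exact MulAction.bijective u

end Sah

/-! ### Sah's lemma for Mathlib's `groupCohomology.H1` -/

section Rep

variable {k G : Type u} [CommRing k] [Group G] (A : Rep k G)

/-- **Sah's lemma for `H¹(G, A)`** (`A : Rep k G`): if `g ∈ Z(G)` and `ρ(g) − 1` is bijective on
`A`, then every `1`-cocycle maps to `0` in `H¹(G, A)`.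
[cite: Sah1968, Prop. 2.7 (b) and its proof, p. 60] -/
theorem H1π_eq_zero_of_mem_center_of_bijective {g : G} (hg : g ∈ Subgroup.center G)
    (hbij : Function.Bijective fun x : A => A.ρ g x - x) (f : cocycles₁ A) : H1π A f = 0 := by
  rw [H1π_eq_zero_iff]
  have hf := (mem_cocycles₁_iff (A := A) f).1 f.2
  obtain ⟨x, hgx⟩ := hbij.2 (f g)
  have hgx : A.ρ g x - x = f g := hgx
  refine ⟨x, funext fun σ => ?_⟩
  have hσg : σ * g = g * σ := Subgroup.mem_center_iff.1 hg σ
  have h1 := hf g σ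
  have h2 := hf σ g
  rw [← hσg] at h1
  have key : A.ρ g (f σ) - f σ = A.ρ σ (f g) - f g :=
    sub_eq_sub_iff_add_eq_add.2 (h1.symm.trans h2)
  have comm : A.ρ g (A.ρ σ x) = A.ρ σ (A.ρ g x) := by
    rw [← Module.End.mul_apply, ← map_mul, ← hσg, map_mul, Module.End.mul_apply]
  have e : A.ρ g (A.ρ σ x - x) - (A.ρ σ x - x) = A.ρ σ (A.ρ g x - x) - (A.ρ g x - x) := by
    rw [map_sub, map_sub, comm]
    abel
  show A.ρ σ x - x = f σ
  apply hbij.1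
  show A.ρ g (A.ρ σ x - x) - (A.ρ σ x - x) = A.ρ g (f σ) - f σ
  rw [e, hgx, key]

/-- **Sah's lemma: `H¹(G, A) = 0`** for `A : Rep k G` whenever some central `g ∈ G` has
`ρ(g) − 1` bijective on `A` (Sah 1968, Prop. 2.7 (b) in degree `1`).
[cite: Sah1968, Prop. 2.7 (b) and its proof, p. 60] -/
theorem subsingleton_H1_of_mem_center_of_bijective {g : G} (hg : g ∈ Subgroup.center G)
    (hbij : Function.Bijective fun x : A => A.ρ g x - x) : Subsingleton (H1 A) := by
  have h0 : ∀ a : H1 A, a = 0 := fun a =>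
    H1_induction_on a (fun f => H1π_eq_zero_of_mem_center_of_bijective A hg hbij f)
  exact ⟨fun a b => (h0 a).trans (h0 b).symm⟩

end Rep

/-! ### The Lang–Mazur Kummer argument (CW, proof of Theorem 11) -/

section Kummer

variable {G M : Type*} [Group G] [AddCommGroup M] [DistribMulAction G M]

/-- The Kummer cocycle of an element: `σ ↦ σ • y − y` is a `1`-cocycle (CW p. 231: "the map
`c_σ = σ α_n ⊖ α_n` plainly defines a cocycle"). [folklore] -/
theorem isCocycle₁_smul_sub (y : M) : IsCocycle₁ (fun σ : G => σ • y - y) := fun σ τ => by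
  show (σ * τ) • y - y = σ • (τ • y - y) + (σ • y - y)
  rw [mul_smul, smul_sub]
  abel

/-- **The Kummer step of Lang–Mazur's proof of CW Theorem 11.** Let `φ` be a `G`-equivariant
additive endomorphism of `M` (CW: `φ = [π^{n+1}]` on `M = ℰ(Φ_∞)`), `α ∈ M^G` (CW: `α ∈ ℰ(𝔭)`)
and `y ∈ M` with `φ y = α` (CW: "suppose that `α_n` belongs to `Φ_∞`"). If every `1`-cocycle of
`G` with values in `ker φ` is the coboundary of an element of `ker φ` (`H¹(G, ker φ) = 0`), then
`α = φ β` with `β ∈ M^G` (CW: "`α_n ⊖ v_n` lies in `K_𝔭`, and so `α` belongs to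
`[π^{n+1}] ℰ(𝔭)`"). [cite: CoatesWiles1977, §3 p. 231 (proof of Thm. 11)] -/
theorem exists_fixed_apply_eq_of_forall_isCocycle₁ (φ : M →+ M)
    (hφ : ∀ (σ : G) (x : M), φ (σ • x) = σ • φ x) {α y : M} (hα : ∀ σ : G, σ • α = α)
    (hy : φ y = α)
    (hH1 : ∀ f : G → M, IsCocycle₁ f → (∀ σ, φ (f σ) = 0) →
      ∃ v : M, φ v = 0 ∧ ∀ σ : G, σ • v - v = f σ) :
    ∃ β : M, (∀ σ : G, σ • β = β) ∧ φ β = α := by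
  obtain ⟨v, hv0, hv⟩ := hH1 (fun σ => σ • y - y) (isCocycle₁_smul_sub y)
    (fun σ => by rw [map_sub, hφ, hy, hα, sub_self])
  refine ⟨y - v, fun σ => ?_, by rw [map_sub, hy, hv0, sub_zero]⟩
  rw [smul_sub]
  exact sub_eq_sub_iff_sub_eq_sub.1 (hv σ).symm

/-- **The Kummer step under Sah's hypothesis.** As `exists_fixed_apply_eq_of_forall_isCocycle₁`,
with `H¹(G, ker φ) = 0` supplied by Sah's lemma: some `g ∈ Z(G)` has `x ↦ g • x − x` bijective
on `ker φ` (CW: `G_∞` is abelian and `χ(g) − 1 ∈ ℤ_p^×` on `ℰ_{π^{n+1}}`).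
[cite: CoatesWiles1977, §3 p. 231 (proof of Thm. 11)] -/
theorem exists_fixed_apply_eq_of_mem_center (φ : M →+ M)
    (hφ : ∀ (σ : G) (x : M), φ (σ • x) = σ • φ x) {g : G} (hg : g ∈ Subgroup.center G)
    (hbij : Set.BijOn (fun x : M => g • x - x) {x | φ x = 0} {x | φ x = 0}) {α y : M}
    (hα : ∀ σ : G, σ • α = α) (hy : φ y = α) :
    ∃ β : M, (∀ σ : G, σ • β = β) ∧ φ β = α := by
  refine exists_fixed_apply_eq_of_forall_isCocycle₁ φ hφ hα hy fun f hf hf0 => ?_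
  have hT : ∀ (σ : G) (x : M), x ∈ φ.ker → σ • x ∈ φ.ker := fun σ x hx => by
    rw [AddMonoidHom.mem_ker] at hx ⊢
    rw [hφ, hx, smul_zero]
  have hbij' : Set.BijOn (fun x : M => g • x - x) (φ.ker : Set M) (φ.ker : Set M) := by
    have hs : ((φ.ker : AddSubgroup M) : Set M) = {x | φ x = 0} :=
      Set.ext fun x => AddMonoidHom.mem_ker
    rw [hs]
    exact hbij
  obtain ⟨x, hx, h⟩ := exists_eq_smul_sub_of_mem_center_of_bijOn hg φ.ker hT hbij' hf
    (fun σ => (AddMonoidHom.mem_ker).2 (hf0 σ))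
  exact ⟨x, (AddMonoidHom.mem_ker).1 hx, h⟩

/-- Powers of a `G`-equivariant additive endomorphism are `G`-equivariant. [folklore] -/
theorem pow_apply_smul (π : AddMonoid.End M) (hπ : ∀ (σ : G) (x : M), π (σ • x) = σ • π x)
    (n : ℕ) (σ : G) (x : M) : (π ^ n) (σ • x) = σ • (π ^ n) x := by
  induction n with
  | zero => simp
  | succ n ih =>
    rw [pow_succ']
    show π ((π ^ n) (σ • x)) = σ • π ((π ^ n) x)
    rw [ih, hπ]

/-- **Coates–Wiles, Theorem 11 — the algebraic skeleton of the Lang–Mazur proof.** Let `G` act on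
`M`, let `π` be a `G`-equivariant additive endomorphism of `M`, and assume: (Sah) some
`g ∈ Z(G)` has `x ↦ g • x − x` bijective on `ker π^{n+1}` for every `n`; (separation)
`⋂_n π^{n+1}(M^G) = 0`. Then for every `G`-fixed `α ≠ 0` there is `N` such that for all `n ≥ N`
no `y ∈ M` satisfies `π^{n+1} y = α`. In CW (§3 p. 231): `G = G_∞`, `M = ℰ(Φ_∞)`,
`M^G = ℰ(𝔭)`, `ℰ_{π^{n+1}} = ker [π^{n+1}]` (all `π`-power torsion of `ℰ(𝔭̄)` lies in `Φ_∞`),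
separation because `[π^{n+1}] ℰ(𝔭) ⊆ ℰ(𝔭^{n+2})`; conclusion: `α_n ∉ Φ_∞`, i.e. `Φ_∞(α_n)/Φ_∞`
is non-trivial for all large `n` — the first half of Theorem 11 (the ramification half is local
class field theory and is not formalised here).
[cite: CoatesWiles1977, §3 p. 231 (Thm. 11 and its proof)] -/
theorem eventually_forall_pow_apply_ne_of_mem_center (π : AddMonoid.End M)
    (hπ : ∀ (σ : G) (x : M), π (σ • x) = σ • π x) {g : G} (hg : g ∈ Subgroup.center G)
    (hbij : ∀ n : ℕ, Set.BijOn (fun x : M => g • x - x)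
      {x | (π ^ (n + 1)) x = 0} {x | (π ^ (n + 1)) x = 0})
    (hsep : ∀ β : M, (∀ n : ℕ, ∃ γ : M, (∀ σ : G, σ • γ = γ) ∧ (π ^ (n + 1)) γ = β) → β = 0)
    {α : M} (hα : ∀ σ : G, σ • α = α) (hα0 : α ≠ 0) :
    ∃ N : ℕ, ∀ n : ℕ, N ≤ n → ∀ y : M, (π ^ (n + 1)) y ≠ α := by
  by_contra hN
  push Not at hN
  refine hα0 (hsep α fun n => ?_)
  obtain ⟨m, hnm, y, hy⟩ := hN n
  -- Kummer + Sah at level `m`: `α = π^{m+1} β` with `β` fixed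
  obtain ⟨β, hβ, hβα⟩ := exists_fixed_apply_eq_of_mem_center (G := G) (π ^ (m + 1))
    (pow_apply_smul π hπ (m + 1)) hg (hbij m) hα hy
  -- then `γ = π^{m-n} β` is fixed and `π^{n+1} γ = α`
  refine ⟨(π ^ (m - n)) β, fun σ => by rw [← pow_apply_smul π hπ, hβ], ?_⟩
  have hmn : n + 1 + (m - n) = m + 1 := by omega
  show (π ^ (n + 1) * π ^ (m - n)) β = α
  rw [← pow_add, hmn]
  exact hβα

end Kummer

/-! ### The ramification half of Theorem 11: the Kummer extension is not abelian over the base -/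

section NonAbelian

variable {G M : Type*} [Group G] [AddCommGroup M] [DistribMulAction G M]

/-- **Equivariance of the Kummer map** (CW p. 231, "`G_0` acts on `G(Φ_∞(α_n)/Φ_∞)` via the
first power of the character `χ`"; also (48), p. 250). Let `φ` be a `G`-equivariant additive
endomorphism of `M`, `y ∈ M` with `φ y` fixed by `G` (CW: `y = α_n`, `φ = [π^{n+1}]`,
`φ y = α ∈ ℰ(𝔭)`), and `τ ∈ G` acting trivially on `ker φ` (CW: `τ ∈ G(K̄_𝔭/Φ_∞)`, all of
`ℰ_{π^{n+1}}` being rational over `Φ_n ⊆ Φ_∞`). Then for every `σ ∈ G`: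
`(σ τ σ⁻¹) • y − y = σ • (τ • y − y)`. [cite: CoatesWiles1977, §3 p. 231 (proof of Thm. 11)] -/
theorem conj_smul_sub_eq_smul (φ : M →+ M) (hφ : ∀ (σ : G) (x : M), φ (σ • x) = σ • φ x)
    {y : M} (hy : ∀ σ : G, σ • φ y = φ y) {τ : G} (hτ : ∀ x : M, φ x = 0 → τ • x = x)
    (σ : G) : (σ * τ * σ⁻¹) • y - y = σ • (τ • y - y) := by
  have hz : φ (σ⁻¹ • y - y) = 0 := by rw [map_sub, hφ, hy, sub_self]
  have hτz : τ • (σ⁻¹ • y - y) = σ⁻¹ • y - y := hτ _ hz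
  rw [smul_sub] at hτz
  have h1 : τ • σ⁻¹ • y = σ⁻¹ • y - y + τ • y := by
    rw [← hτz]
    abel
  rw [mul_smul, mul_smul, h1, smul_add, smul_sub, smul_inv_smul, smul_sub]
  abel

/-- **CW Theorem 11, ramification half — the algebraic part.** In the situation of
`conj_smul_sub_eq_smul`, suppose some `g ∈ G` has `x ↦ g • x − x` injective on `ker φ` (CW:
`g ∈ G_0` with `χ(g) − 1 ∈ ℤ_p^×`) and commutes with `τ` in its action on `y`:
`(g τ g⁻¹) • y = τ • y` (CW: this holds for all `τ ∈ G(K̄_𝔭/Φ_∞)` if `Φ_∞(α_n)` is abelian over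
`K_𝔭`). Then `τ` fixes `y`. Contrapositively: once `Φ_∞(α_n) ≠ Φ_∞` (first half,
`eventually_forall_pow_apply_ne_of_mem_center`), `Φ_∞(α_n)` is not abelian over `K_𝔭`, hence —
all unramified extensions of `Φ_∞` being abelian over `K_𝔭` (local class field theory, not
formalised here) — `Φ_∞(α_n)/Φ_∞` is ramified. [cite: CoatesWiles1977, §3 p. 231 (proof of Thm. 11)] -/
theorem smul_eq_self_of_conj_smul_eq (φ : M →+ M) (hφ : ∀ (σ : G) (x : M), φ (σ • x) = σ • φ x)
    {y : M} (hy : ∀ σ : G, σ • φ y = φ y) {τ : G} (hτ : ∀ x : M, φ x = 0 → τ • x = x) {g : G}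
    (hinj : ∀ x : M, φ x = 0 → g • x - x = 0 → x = 0) (hab : (g * τ * g⁻¹) • y = τ • y) :
    τ • y = y := by
  have hc : φ (τ • y - y) = 0 := by rw [map_sub, hφ, hy, sub_self]
  have hgc : g • (τ • y - y) = τ • y - y := by
    rw [← conj_smul_sub_eq_smul φ hφ hy hτ g, hab]
  exact sub_eq_zero.1 (hinj _ hc (by rw [hgc, sub_self]))

/-- The contrapositive, as used by Coates–Wiles: if `y` is moved by some `τ` acting trivially
on `ker φ` (the Kummer extension is non-trivial), then for any `g` with `g − 1` injective on
`ker φ` some such `τ` fails to commute with `g` on `y` — the extension generated by `y` is not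
abelian over the fixed field of `g`. [cite: CoatesWiles1977, §3 p. 231 (proof of Thm. 11)] -/
theorem exists_conj_smul_ne (φ : M →+ M) (hφ : ∀ (σ : G) (x : M), φ (σ • x) = σ • φ x)
    {y : M} (hy : ∀ σ : G, σ • φ y = φ y) {g : G}
    (hinj : ∀ x : M, φ x = 0 → g • x - x = 0 → x = 0)
    (h : ∃ τ : G, (∀ x : M, φ x = 0 → τ • x = x) ∧ τ • y ≠ y) :
    ∃ τ : G, (∀ x : M, φ x = 0 → τ • x = x) ∧ (g * τ * g⁻¹) • y ≠ τ • y := by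
  obtain ⟨τ, hτ, hne⟩ := h
  exact ⟨τ, hτ, fun hab => hne (smul_eq_self_of_conj_smul_eq φ hφ hy hτ hinj hab)⟩

end NonAbelian

/-! ### Lemma 12 (anomalous primes): the arithmetic step -/

section Anomalous

/-- For `p ≥ 7`, an integer `a` with `a² ≤ 4p` and `a ≡ 1 (mod p)` equals `1` (Coates–Wiles,
proof of Lemma 12, p. 232: "As `|π| = √p`, this congruence implies that `π + π̄ = 1` for `p > 5`").
[cite: CoatesWiles1977, Lemma 12 and its proof, pp. 231–232] -/
theorem eq_one_of_modEq_one_of_sq_le {p : ℕ} (hp : 7 ≤ p) {a : ℤ} (ha : a ^ 2 ≤ 4 * p)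
    (h1 : a ≡ 1 [ZMOD p]) : a = 1 := by
  obtain ⟨k, hk⟩ := h1.symm.dvd
  by_contra hne
  have hk0 : k ≠ 0 := by
    rintro rfl
    exact hne (by linear_combination hk)
  have hp' : (7 : ℤ) ≤ p := by exact_mod_cast hp
  rcases lt_or_gt_of_ne hk0 with hlt | hgt
  · have hk1 : k ≤ -1 := by omega
    have hpk : (p : ℤ) * k ≤ -p := by nlinarith
    have ha' : (p : ℤ) - 1 ≤ -a := by linarith
    nlinarith [mul_self_le_mul_self (by linarith : (0 : ℤ) ≤ p - 1) ha']
  · have hk1 : 1 ≤ k := by omega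
    have hpk : (p : ℤ) ≤ p * k := by nlinarith
    nlinarith

/-- **Anomalous primes, congruence form** (Coates–Wiles, Definition p. 231: `p` is *anomalous*
for `E` if `π + π̄ = 1`, i.e. the trace of Frobenius of `E` modulo `𝔭` equals `1`; Lemma 12,
p. 232: for `p > 5` this is equivalent to the congruence `π + π̄ ≡ 1 mod p` furnished by the
norm groups of `Φ_0` and `K_𝔭(μ_p)`). For a prime `p > 5` of good reduction of the globally
minimal `W/ℚ`: `a_p ≡ 1 (mod p) ↔ a_p = 1`, by Hasse's bound `a_p² ≤ 4p`
(`DeuringLadic.frobeniusTrace_sq_le`). Thus the hypothesis `W.frobeniusTrace p ≠ 1` of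
`CoatesWiles1977_L_one_div_period_mem_prime` is "`p` is not anomalous" in the congruence form in
which local class field theory delivers it. [cite: CoatesWiles1977, Lemma 12 and its proof, pp. 231–232] -/
theorem frobeniusTrace_modEq_one_iff (W : WeierstrassCurve ℚ) [W.IsElliptic]
    [W.IsGloballyMinimal] {p : ℕ} (hp : p.Prime) (h5 : 5 < p)
    (hΔ : ¬ (p : ℤ) ∣ WeierstrassCurve.minimalDiscriminantInt W) :
    W.frobeniusTrace p ≡ 1 [ZMOD p] ↔ W.frobeniusTrace p = 1 := by
  refine ⟨fun h => eq_one_of_modEq_one_of_sq_le ?_ (DeuringLadic.frobeniusTrace_sq_le W hp hΔ) h,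
    fun h => by rw [h]⟩
  have h6 : p ≠ 6 := by
    rintro rfl
    exact absurd hp (by decide)
  omega

/-- The non-anomalous hypothesis of `CoatesWiles1977_L_one_div_period_mem_prime` in congruence
form: for `p > 5` of good reduction, `a_p ≠ 1 ↔ ¬ (a_p ≡ 1 mod p)`.
[cite: CoatesWiles1977, Lemma 12 and its proof, pp. 231–232] -/
theorem frobeniusTrace_ne_one_iff_not_modEq (W : WeierstrassCurve ℚ) [W.IsElliptic]
    [W.IsGloballyMinimal] {p : ℕ} (hp : p.Prime) (h5 : 5 < p)
    (hΔ : ¬ (p : ℤ) ∣ WeierstrassCurve.minimalDiscriminantInt W) :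
    W.frobeniusTrace p ≠ 1 ↔ ¬ (W.frobeniusTrace p ≡ 1 [ZMOD p]) :=
  not_congr (frobeniusTrace_modEq_one_iff W hp h5 hΔ).symm

end Anomalous

end CoatesWiles1977

end Literature.NumberTheory.EllipticCurves
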